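import Mathlib
import HarnessLib
import Literature.Analysis.FluidPDE.SteadyNSLiouville
import Literature.Analysis.FluidPDE.SteadyLiouvilleCriteria
import Literature.Analysis.FluidPDE.SteadyLiouvilleCriteriaProofs
import Literature.Analysis.FluidPDE.SteadyLiouvilleTsaiEnergy
import Literature.Analysis.FluidPDE.SteadyNSLiouvilleL3AnnulusProofs
import Literature.Analysis.FluidPDE.SteadyNSLiouvilleWangYangHolds
import Literature.Analysis.FluidPDE.SereginWangAnnularLiouvilleHolds
import Literature.Analysis.FluidPDE.SereginWangWeakAnnularLiouville
import Literature.Analysis.FluidPDE.SverakLandauClassification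
import Literature.Analysis.FluidPDE.SverakLandauClassificationProofs
import Literature.Analysis.FunctionSpaces.WeakLp
import Literature.Analysis.FluidPDE.WeakL3SteadyLiouville
import Literature.Analysis.FluidPDE.SteadyHelicalLiouville
import Literature.Analysis.FluidPDE.PeriodicSlabSteadyLiouville
import Summits.NavierStokesRegularity.NavierStokesRegularity.Theses.GaldiLiouvilleGate
import Summits.NavierStokesRegularity.NavierStokesRegularity.Theorems.GaldiLiouvilleGateParabolicGaldiLiouvilleKnownCases

/-!
# Blow-up scenario census, block S: STEADY scenarios (Leray's `D`-solutions; Galdi's Liouville problem)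

Cell `pub/ns-census` (director-ns KEY req102, D-0154 (A), 2026-08-28), typer seat `ns-census-typer-2`.
Kernel-checked INDEX of block S of `SCENARIO-CENSUS.md` v1.1 (ns-census-lead; row keys fixed there): steady
solutions on `ℝ³` — the time-independent sub-case of the ancient block A (`ScenarioCensusAncient.lean`;
the parabolic gate between them is row A12 there). A steady solution with viscosity `ν` is rendered by
the tree predicate `Literature.Analysis.FluidPDE.IsLerayProfile ν 0 U P` (Leray's profile system with
`a = 0`: a `C²` pair solving `−νΔU + (U·∇)U + ∇P = 0`, `div U = 0` pointwise); a `D`-solution adds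
`∫ ‖∇U‖²_F < ∞` and `U → 0` at infinity. Sister files: `ScenarioCensusAncient.lean`,
`ScenarioCensusRotating.lean` (this seat); `ScenarioCensusForward.lean`, `ScenarioCensusSelfSimilar.lean`
(typer-1).

## What a row is

`Row_<key> : Prop` is the exact Liouville statement of census cell `<key>`; when the tree already holds
it (named fact / registered open problem / route decl) the row IS that declaration by name. Values
decided by the kernel: `EXCLUDED-IN-TREE` ⇔ `theorem row_<key>_excluded : Row_<key>` below (one-line
application of a tree theorem); `EXCLUDED-IN-PRINT-NOT-TREE` = the row is a typed named fact WITHOUT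
`_holds` (S2); `OPEN-…` = registered open problem / route item (S1, S3, S5).

| key | cell (symmetry · class) | `Row_…` body | value |
|---|---|---|---|
| S1 | none · D-solution, ν = 1 | `SteadyDSolutionLiouvilleProblem` (= item `GaldiLiouvilleGate.GaldiLiouville` ⟨0895⟩ at ν = 1; negative side ⟨0898⟩) | OPEN-WITH-LINE |
| S1a | none · D-solution ∩ L^{9/2} | fact `galdi_liouville_nineHalves` (Galdi X.9.5) | EXCLUDED-IN-TREE |
| S1b | none · smooth steady, Seregin–Wang annular rate (q = ℓ = 3) | fact `SereginWang2020_annular_liouville` | EXCLUDED-IN-TREE |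
| S1c | axisym no swirl · parabolic-gate class (bounded ancient mild, smooth, L⁶) | statement (KNSS 5.2 case of A12) | EXCLUDED-IN-TREE |
| S1d | none · smooth steady, Tsai's vanishing annular liminf | fact `Tsai2021_annular_liouville` | EXCLUDED-IN-TREE |
| S1e | none · smooth steady, L³-annulus growth | fact `sereginWang_liouville_L3_annulus` | EXCLUDED-IN-TREE |
| S1f / S1g | none · D-solution, log-improved velocity / vorticity classes | facts `wangYang2026_liouville_{velocity,vorticity}_log` | EXCLUDED-IN-TREE |
| S1h | none · smooth steady, weak annular Morrey rate (ℓ = ∞) | fact `SereginWang2020_weak_annular_liouville` | EXCLUDED-IN-TREE |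
| S2 | axisym no swirl · D-solution | fact `KorobkovPileckasRusso2015_liouville_noSwirl` (no `_holds`) | EXCLUDED-IN-PRINT-NOT-TREE |
| S3 | axisym with swirl · D-solution | item `GaldiLiouvilleGate.AxisymGaldiLiouville` ⟨0896⟩ | OPEN-NO-LINE |
| S4 | scale-invariant (−1-homogeneous) · smooth on ℝ³ ∖ {0} | fact `Sverak2011_landauClassification` (Landau classification) | EXCLUDED-IN-TREE (classification) |
| S5 | none · Galdi critical rate ‖U‖ ≲ (1+‖y‖)^{−2/3} | item `GaldiLiouvilleGate.CriticalRateLiouville` ⟨0897⟩ | OPEN-WITH-LINE (conditional) |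

(S1d–S1h split the lead's composite S1b into one decl per cell; S6 — steady helical Liouville, in print
arXiv:2312.10382 — is NO-VOCAB and lives in the markdown only.) No summit statement is proved or claimed
here; nothing in this file is a claim about Navier–Stokes regularity.
-/

noncomputable section

set_option linter.dupNamespace false

open MeasureTheory Set Filter Topology
open scoped ENNReal NNReal

namespace Summit.NavierStokesRegularity.NavierStokesRegularity.Theorems.ScenarioCensus

open Literature.Analysis

/-- Census row S1 — (steady · no symmetry · `D`-solution): Galdi's Liouville problem — a smooth steady
solution (`ν = 1`) on `ℝ³` with finite Dirichlet integral tending to `0` at infinity vanishes —, BY NAME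
the registered open problem `SteadyDSolutionLiouvilleProblem`. Value: OPEN-WITH-LINE (route
GaldiLiouvilleGate: item `GaldiLiouville` ⟨0895⟩ is this row for every `ν > 0`; negative side
`NontrivialDSolutionExists` ⟨0898⟩, hard core). -/
def Row_S1 : Prop :=
  FluidPDE.SteadyDSolutionLiouvilleProblem

/-- The route item `GaldiLiouvilleGate.GaldiLiouville` (all `ν > 0`) gives row S1 (its case `ν = 1`). -/
theorem row_S1_of_galdiLiouville
    (h : Summit.NavierStokesRegularity.NavierStokesRegularity.Theses.GaldiLiouvilleGate.GaldiLiouville) :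
    Row_S1 :=
  h 1 one_pos

/-- Census row S1a — S1 with `U ∈ L^{9/2}(ℝ³)` (Galdi 2011 Thm X.9.5; every `ν > 0`), BY NAME the fact
`galdi_liouville_nineHalves`. Value: EXCLUDED-IN-TREE. -/
def Row_S1a : Prop :=
  FluidPDE.galdi_liouville_nineHalves

/-- S1a is EXCLUDED-IN-TREE: `galdi_liouville_nineHalves_holds`. -/
theorem row_S1a_excluded : Row_S1a :=
  FluidPDE.galdi_liouville_nineHalves_holds

/-- Census row S1b — smooth steady solutions with Seregin–Wang's annular quantity bounded at the critical
rate `2/3` (St. Petersburg Math. J. 31 (2020) Thm 1.1, `q = ℓ = 3`; no decay assumed), BY NAME the fact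
`SereginWang2020_annular_liouville`. Value: EXCLUDED-IN-TREE. -/
def Row_S1b : Prop :=
  FluidPDE.SereginWang2020_annular_liouville

/-- S1b is EXCLUDED-IN-TREE: `SereginWang2020_annular_liouville_holds`. -/
theorem row_S1b_excluded : Row_S1b :=
  FluidPDE.SereginWang2020_annular_liouville_holds

/-- Census row S1c — (axisymmetric WITHOUT swirl · the parabolic-gate class of A12: bounded ancient mild
`ν = 1`, smooth on `(−∞,0) × ℝ³`, uniformly bounded enstrophy, `L⁶` slices): `v ≡ 0` (KNSS 2009 Thm 5.2
case; the steady swirl-free `D`-solutions form its time-independent sub-class). Value: EXCLUDED-IN-TREE.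
(Twin under `r‖v‖ ≤ C`: `…Birth.parabolicGaldiLiouville_axisymmetric_bound_C_over_r`.) -/
def Row_S1c : Prop :=
  ∀ v : ℝ → EuclideanSpace ℝ (Fin 3) → EuclideanSpace ℝ (Fin 3),
    FluidPDE.IsBoundedAncientMildSolution 1 v →
    ContDiffOn ℝ (⊤ : ℕ∞) (Function.uncurry v) (Set.Iio 0 ×ˢ Set.univ) →
    (∃ C : NNReal, ∀ s < 0,
        ∫⁻ y, ENNReal.ofReal (FluidPDE.frobeniusNormSq (fderiv ℝ (v s) y)) ≤ C) →
    (∀ s < 0, MemLp (v s) 6 volume) →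
    (∀ t < 0, FluidPDE.IsAxisymmetric (v t)) → (∀ t < 0, FluidPDE.HasNoSwirl (v t)) →
      ∀ s < 0, ∀ y, v s y = 0

/-- S1c is EXCLUDED-IN-TREE: `Theorems.ParabolicGaldiLiouville.Birth.parabolicGaldiLiouville_axisymmetric_noSwirl`. -/
theorem row_S1c_excluded : Row_S1c :=
  ParabolicGaldiLiouville.Birth.parabolicGaldiLiouville_axisymmetric_noSwirl

/-- Census row S1d — smooth steady solutions with vanishing annular `liminf` (Tsai 2021 Thm 1.1 (a); no
decay assumed), BY NAME the fact `Tsai2021_annular_liouville`. Value: EXCLUDED-IN-TREE. -/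
def Row_S1d : Prop :=
  FluidPDE.Tsai2021_annular_liouville

/-- S1d is EXCLUDED-IN-TREE: `Tsai2021_annular_liouville_holds`. -/
theorem row_S1d_excluded : Row_S1d :=
  FluidPDE.Tsai2021_annular_liouville_holds

/-- Census row S1e — steady solutions whose `L³` norm on dyadic annuli grows slower than the Seregin–Wang
threshold, BY NAME the fact `sereginWang_liouville_L3_annulus`. Value: EXCLUDED-IN-TREE. -/
def Row_S1e : Prop :=
  FluidPDE.sereginWang_liouville_L3_annulus

/-- S1e is EXCLUDED-IN-TREE: `sereginWang_liouville_L3_annulus_holds`. -/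
theorem row_S1e_excluded : Row_S1e :=
  FluidPDE.sereginWang_liouville_L3_annulus_holds

/-- Census row S1f — `D`-solutions in the Wang–Yang 2026 log-improved VELOCITY class, BY NAME the fact
`wangYang2026_liouville_velocity_log`. Value: EXCLUDED-IN-TREE. -/
def Row_S1f : Prop :=
  FluidPDE.wangYang2026_liouville_velocity_log

/-- S1f is EXCLUDED-IN-TREE: `wangYang2026_liouville_velocity_log_holds`. -/
theorem row_S1f_excluded : Row_S1f :=
  FluidPDE.wangYang2026_liouville_velocity_log_holds

/-- Census row S1g — `D`-solutions in the Wang–Yang 2026 log-improved VORTICITY class, BY NAME the fact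
`wangYang2026_liouville_vorticity_log`. Value: EXCLUDED-IN-TREE. -/
def Row_S1g : Prop :=
  FluidPDE.wangYang2026_liouville_vorticity_log

/-- S1g is EXCLUDED-IN-TREE: `wangYang2026_liouville_vorticity_log_holds`. -/
theorem row_S1g_excluded : Row_S1g :=
  FluidPDE.wangYang2026_liouville_vorticity_log_holds

/-- Census row S1h — smooth steady solutions with bounded WEAK annular Morrey quantity (Seregin–Wang 2020
Thm 1.1 (ii), `ℓ = ∞`, `12/5 < q < 3`; contains `U ∈ L^{3,∞}(ℝ³)` at the critical rate), BY NAME the fact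
`SereginWang2020_weak_annular_liouville`. Value: EXCLUDED-IN-TREE. -/
def Row_S1h : Prop :=
  FluidPDE.SereginWang2020_weak_annular_liouville

/-- S1h is EXCLUDED-IN-TREE: `SereginWang2020_weak_annular_liouville_holds`. -/
theorem row_S1h_excluded : Row_S1h :=
  FluidPDE.SereginWang2020_weak_annular_liouville_holds

/-- Census row S2 — (steady · axisymmetric WITHOUT swirl · `D`-solution, any `ν > 0`): Liouville holds
(Korobkov–Pileckas–Russo, JMFM 17 (2015)), BY NAME the typed fact
`KorobkovPileckasRusso2015_liouville_noSwirl`, which has NO `_holds` in the tree. Value: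
EXCLUDED-IN-PRINT-NOT-TREE (statement typed, proof not in tree). -/
def Row_S2 : Prop :=
  FluidPDE.KorobkovPileckasRusso2015_liouville_noSwirl

/-- Census row S3 — (steady · axisymmetric WITH swirl · `D`-solution), BY NAME the route item
`GaldiLiouvilleGate.AxisymGaldiLiouville` (⟨0896⟩; open in print). Value: OPEN-NO-LINE (item, no line). -/
def Row_S3 : Prop :=
  Summit.NavierStokesRegularity.NavierStokesRegularity.Theses.GaldiLiouvilleGate.AxisymGaldiLiouville

/-- The full item `GaldiLiouville` ⟨0895⟩ contains the axisymmetric row S3 (drop the symmetry hypothesis). -/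
theorem row_S3_of_galdiLiouville
    (h : Summit.NavierStokesRegularity.NavierStokesRegularity.Theses.GaldiLiouvilleGate.GaldiLiouville) :
    Row_S3 :=
  fun ν hν U P hprof _ hU hP hD hlim => h ν hν U P hprof hU hP hD hlim

/-- Census row S4 — (steady · scale-invariant `λ u(λx) = u(x)`, smooth on `ℝ³ ∖ {0}`): such solutions are
exactly the Landau solutions (Šverák 2011 Thm 1) — a CLASSIFICATION, not a triviality statement (Landau
solutions are not `D`-solutions) —, BY NAME the fact `Sverak2011_landauClassification`.
Value: EXCLUDED-IN-TREE (classification). -/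
def Row_S4 : Prop :=
  FluidPDE.Sverak2011_landauClassification

/-- S4 is EXCLUDED-IN-TREE (as a classification): `Sverak2011_landauClassification_holds`. -/
theorem row_S4_excluded : Row_S4 :=
  FluidPDE.Sverak2011_landauClassification_holds

/-- Census row S5 — (steady · no symmetry · `a = 0` profile at Galdi's critical rate
`‖U‖ ≲ (1+‖y‖)^{−2/3}`, `‖∇U‖ ≲ (1+‖y‖)^{−5/3}`, `P → 0`): `U ≡ 0`, BY NAME the route item
`GaldiLiouvilleGate.CriticalRateLiouville` (⟨0897⟩, a conditional bridge on a named fact in its route).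
Value: OPEN-WITH-LINE (conditional). -/
def Row_S5 : Prop :=
  Summit.NavierStokesRegularity.NavierStokesRegularity.Theses.GaldiLiouvilleGate.CriticalRateLiouville

/-! ## Appendix 1 (append-only round 2): the whole-space weak-`L³` steady Liouville theorem -/

/-- Census row S1i — (steady · no symmetry · `U ∈ L^{3,∞}(ℝ³)`, any `ν > 0`, no decay / Dirichlet
hypothesis): a `C²` steady solution `IsLerayProfile ν 0 U P` with `U` in weak-`L³`
(`Literature.Analysis.FunctionSpaces.MemWeakLp U 3 volume`) vanishes (Seregin–Wang 2020 Thm 1.1 (ii) /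
Tsai 2021 Thm 1.1 (a), `δ = 1`); contains the critical-rate profiles `‖U‖ ≲ 1/‖x‖`. Value: EXCLUDED-IN-TREE. -/
def Row_S1i : Prop :=
  ∀ ν : ℝ, 0 < ν → ∀ (U : EuclideanSpace ℝ (Fin 3) → EuclideanSpace ℝ (Fin 3))
    (P : EuclideanSpace ℝ (Fin 3) → ℝ), FluidPDE.IsLerayProfile ν 0 U P →
      FunctionSpaces.MemWeakLp U 3 volume → U = 0

/-- S1i is EXCLUDED-IN-TREE: `WeakL3SteadyLiouville.eq_zero_of_memWeakLp_three`. -/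
theorem row_S1i_excluded : Row_S1i :=
  fun _ hν _ _ hprof hU => FluidPDE.WeakL3SteadyLiouville.eq_zero_of_memWeakLp_three hν hprof hU

/-! ## Appendix 2 (append-only round 3): the HELICAL steady cell S6 — its `D`-solution part is empty

Census v1.7 row S6 (steady · helical · BOUNDED smooth steady solutions, no decay) is
EXCLUDED-IN-PRINT-NOT-TREE by Han–Wang–Xie, arXiv:2312.10382 (2023), Theorem 1.1: a bounded smooth
helically symmetric steady solution on `ℝ³` is an axial constant `(0,0,C)`; its typed form is the
Literature named fact `HanWangXie2023_helical_liouville` (proposed by this seat, statement-only;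
`Row_S6` will alias it by name in the next append once it has landed). Helical symmetry with pitch
`κ` is written here INLINE, as in the sister rows A8 / A8t / A8v (`ScenarioCensusAncientSymmetry.lean`)
and R8 (`ScenarioCensusRotating.lean`): `U (R_ρ x + κρ e₃) = R_ρ (U x)` for all `ρ`, `x`
(`FluidPDE.rotZ`, `FluidPDE.eZ`; definitionally the Literature predicate `IsHelicallySymmetric κ U`).
What the kernel CAN settle is the helical column of Galdi's own class: a `D`-solution tends to `0` at
infinity, a helically symmetric field of non-zero pitch is periodic along the axis, so the cell
"steady · helical · `D`-solution" (row S6v below) is EMPTY — the steady twin of the vacuous cells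
A8v (ancient, space–time Type I envelope) and F12 (forward, rapidly decaying data). No Navier–Stokes
input is used; nothing here bears on the bounded class of S6, which stays print-only. -/

/-- One full turn about the axis is the identity: `R_{2π} = id`. -/
theorem helical_rotZ_two_pi (y : EuclideanSpace ℝ (Fin 3)) : FluidPDE.rotZ (2 * Real.pi) y = y := by
  ext i
  fin_cases i <;> simp [Real.cos_two_pi, Real.sin_two_pi]

/-- A helically symmetric field of pitch `κ` is invariant under the axial translations by
`n · 2πκ e₃`, `n : ℕ` (take `ρ = 2πn`: full turns are the identity). -/
theorem helical_apply_add_nat_mul_period {κ : ℝ}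
    {U : EuclideanSpace ℝ (Fin 3) → EuclideanSpace ℝ (Fin 3)}
    (hU : ∀ (ρ : ℝ) (x : EuclideanSpace ℝ (Fin 3)),
      U (FluidPDE.rotZ ρ x + (κ * ρ) • FluidPDE.eZ) = FluidPDE.rotZ ρ (U x))
    (n : ℕ) (x : EuclideanSpace ℝ (Fin 3)) :
    U (x + ((n : ℝ) * (κ * (2 * Real.pi))) • FluidPDE.eZ) = U x := by
  induction n with
  | zero => simp
  | succ k ih =>
    have hper : ∀ y : EuclideanSpace ℝ (Fin 3), U (y + (κ * (2 * Real.pi)) • FluidPDE.eZ) = U y := by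
      intro y
      have h := hU (2 * Real.pi) y
      rwa [helical_rotZ_two_pi, helical_rotZ_two_pi] at h
    have hsplit : x + (((k + 1 : ℕ) : ℝ) * (κ * (2 * Real.pi))) • FluidPDE.eZ =
        (x + ((k : ℝ) * (κ * (2 * Real.pi))) • FluidPDE.eZ) + (κ * (2 * Real.pi)) • FluidPDE.eZ := by
      rw [Nat.cast_succ, add_mul, one_mul, add_smul, add_assoc]
    rw [hsplit, hper, ih]

/-- **The decaying helical class is empty.** A helically symmetric field `U : ℝ³ → ℝ³` of non-zero
pitch which tends to `0` at infinity (`Tendsto U (cocompact ℝ³) (𝓝 0)`, as in Galdi's `D`-solution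
class) vanishes identically: for every `ε > 0` it is `ε`-small off a compact set, and every point has
axial translates by multiples of the period `2πκ e₃` outside that set. No equation is used. -/
theorem eq_zero_of_helical_of_tendsto_cocompact {κ : ℝ} (hκ : κ ≠ 0)
    {U : EuclideanSpace ℝ (Fin 3) → EuclideanSpace ℝ (Fin 3)}
    (hU : ∀ (ρ : ℝ) (x : EuclideanSpace ℝ (Fin 3)),
      U (FluidPDE.rotZ ρ x + (κ * ρ) • FluidPDE.eZ) = FluidPDE.rotZ ρ (U x))
    (hlim : Tendsto U (cocompact (EuclideanSpace ℝ (Fin 3))) (𝓝 0)) : U = 0 := by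
  funext x
  set p : ℝ := κ * (2 * Real.pi) with hp_def
  have hp : 0 < |p| := abs_pos.2 (mul_ne_zero hκ (by positivity))
  have heZ : ‖(FluidPDE.eZ : EuclideanSpace ℝ (Fin 3))‖ = 1 := by simp [FluidPDE.eZ]
  refine norm_le_zero_iff.1 (le_of_forall_pos_lt_add fun ε hε => ?_)
  rw [zero_add]
  obtain ⟨K, hK, hKU⟩ := (hasBasis_cocompact.tendsto_iff Metric.nhds_basis_ball).1 hlim ε hε
  obtain ⟨r, hr⟩ := hK.isBounded.subset_closedBall (0 : EuclideanSpace ℝ (Fin 3))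
  obtain ⟨n, hn⟩ := exists_nat_gt ((r + ‖x‖) / |p|)
  have hn' : r + ‖x‖ < (n : ℝ) * |p| := by rwa [div_lt_iff₀ hp] at hn
  set y : EuclideanSpace ℝ (Fin 3) := x + ((n : ℝ) * p) • FluidPDE.eZ with hy_def
  have hy_norm : r < ‖y‖ := by
    have h1 : ‖((n : ℝ) * p) • (FluidPDE.eZ : EuclideanSpace ℝ (Fin 3))‖ = (n : ℝ) * |p| := by
      rw [norm_smul, heZ, mul_one, Real.norm_eq_abs, abs_mul, Nat.abs_cast]
    have h2 : ‖((n : ℝ) * p) • (FluidPDE.eZ : EuclideanSpace ℝ (Fin 3))‖ ≤ ‖y‖ + ‖x‖ := by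
      calc ‖((n : ℝ) * p) • (FluidPDE.eZ : EuclideanSpace ℝ (Fin 3))‖ = ‖y - x‖ := by
            rw [hy_def, add_sub_cancel_left]
        _ ≤ ‖y‖ + ‖x‖ := norm_sub_le _ _
    linarith
  have hyK : y ∈ Kᶜ := by
    intro hyK
    have := hr hyK
    rw [Metric.mem_closedBall, dist_zero_right] at this
    linarith
  have hUy : U y = U x := by
    rw [hy_def, hp_def]
    exact helical_apply_add_nat_mul_period hU n x
  have := hKU y hyK
  rwa [Metric.mem_ball, dist_zero_right, hUy] at this

/-- Census row S6v — (steady · HELICAL: `U (R_ρ x + κρ e₃) = R_ρ (U x)` for all `ρ`, pitch `κ ≠ 0`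
· Galdi's `D`-solution class at any `ν > 0`: `C²` steady solution `IsLerayProfile ν 0 U P` with
finite Dirichlet integral and `U → 0` at infinity): `U = 0` — the helical column of row S1. The cell
is EMPTY (decay to `0` along the unbounded screw orbit), which is why the printed helical Liouville
theorem (Han–Wang–Xie 2023 Thm 1.1 = row S6, BOUNDED solutions, no decay) is the meaningful helical
statement. Value: EXCLUDED-IN-TREE (vacuous), proved below with no Navier–Stokes input. -/
def Row_S6v : Prop :=
  ∀ ν : ℝ, 0 < ν → ∀ κ : ℝ, κ ≠ 0 →
    ∀ (U : EuclideanSpace ℝ (Fin 3) → EuclideanSpace ℝ (Fin 3)) (P : EuclideanSpace ℝ (Fin 3) → ℝ),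
      FluidPDE.IsLerayProfile ν 0 U P →
      (∀ (ρ : ℝ) (x : EuclideanSpace ℝ (Fin 3)),
          U (FluidPDE.rotZ ρ x + (κ * ρ) • FluidPDE.eZ) = FluidPDE.rotZ ρ (U x)) →
      (∫⁻ x, ENNReal.ofReal (FluidPDE.frobeniusNormSq (fderiv ℝ U x)) < ∞) →
      Tendsto U (cocompact (EuclideanSpace ℝ (Fin 3))) (𝓝 0) → U = 0

/-- S6v is EXCLUDED-IN-TREE (vacuous cell): `eq_zero_of_helical_of_tendsto_cocompact`. -/
theorem row_S6v_excluded : Row_S6v :=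
  fun _ _ _ hκ _ _ _ hU _ hlim => eq_zero_of_helical_of_tendsto_cocompact hκ hU hlim

/-! ## Appendix 3 (append-only round 4): census S6 BY NAME — the printed helical Liouville theorem

The Literature named fact `HanWangXie2023_helical_liouville` (`SteadyHelicalLiouville.lean`, landed
after Appendix 2 was written) types Han–Wang–Xie 2023 Thm 1.1 verbatim; row S6 is that declaration by
name. Its hypothesis `IsHelicallySymmetric κ U` is definitionally the inline screw-equivariance of
`Row_S6v` (`row_S6v_isHelicallySymmetric` restates S6v over the predicate, proof by the same term). -/

/-- Census row S6 — (steady · HELICAL, pitch `κ ≠ 0` · BOUNDED smooth steady solutions on `ℝ³`, any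
`ν > 0`, NO decay / Dirichlet hypothesis): `U ≡ C e₃` (Han–Wang–Xie, arXiv:2312.10382 = Sci. China
Math. 69 (2025), Thm 1.1), BY NAME the typed fact `HanWangXie2023_helical_liouville`, which has NO
`_holds` in the tree. Value: EXCLUDED-IN-PRINT-NOT-TREE (statement typed, proof not in tree); the
decaying sub-cell S6v is EXCLUDED-IN-TREE (vacuous). -/
def Row_S6 : Prop :=
  FluidPDE.HanWangXie2023_helical_liouville

/-- Row S6v over the Literature predicate: for `κ ≠ 0`, ANY field `U : ℝ³ → ℝ³` which is
`IsHelicallySymmetric κ` and tends to `0` at infinity vanishes (neither the equation nor the Dirichlet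
hypothesis of S6v is needed) — `eq_zero_of_helical_of_tendsto_cocompact`, the predicate unfolding to
the inline screw-equivariance. -/
theorem row_S6v_isHelicallySymmetric {κ : ℝ} (hκ : κ ≠ 0)
    {U : EuclideanSpace ℝ (Fin 3) → EuclideanSpace ℝ (Fin 3)} (hU : FluidPDE.IsHelicallySymmetric κ U)
    (hlim : Tendsto U (cocompact (EuclideanSpace ℝ (Fin 3))) (𝓝 0)) : U = 0 :=
  eq_zero_of_helical_of_tendsto_cocompact hκ hU hlim

/-- Under the fact S6, the helical steady cell splits cleanly: bounded solutions are the axial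
constants `C e₃` (S6), and those tending to `0` at infinity are `0` (S6v, unconditionally) — so a
NON-constant bounded smooth helically symmetric steady solution would refute the printed theorem. -/
theorem row_S6_eq_const (h : Row_S6) {ν κ : ℝ} (hν : 0 < ν) (hκ : κ ≠ 0)
    {U : EuclideanSpace ℝ (Fin 3) → EuclideanSpace ℝ (Fin 3)} {P : EuclideanSpace ℝ (Fin 3) → ℝ}
    (hUP : FluidPDE.IsLerayProfile ν 0 U P) (hU : ContDiff ℝ (⊤ : ℕ∞) U) (hP : ContDiff ℝ (⊤ : ℕ∞) P)
    (hbdd : ∃ M : ℝ, ∀ x, ‖U x‖ ≤ M) (hsym : FluidPDE.IsHelicallySymmetric κ U) :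
    ∃ C : ℝ, ∀ x, U x = C • FluidPDE.eZ := by
  obtain ⟨C, hC⟩ := h ν hν κ hκ U P hUP hU hP hbdd hsym
  exact ⟨C, fun x => congrFun hC x⟩

/-! ## Appendix 4 (append-only round 5, typer-2 g6): census S7 — bounded steady flows in the
periodic slab `ℝ² × 𝕋_L` (Bang–Gui–Wang–Xie 2025, Thm 1.4), and its small-`Re_L` case (d) as S7d

Row S7 of the census (v1.29) is the printed theorem BY NAME (the Literature fact
`BangGuiWangXie2025_periodicSlab_liouville` packs both printed conclusions in one `Prop`); its
cell — NO symmetry, `sup ‖U‖ < 2πν/L` — is case (d), typed separately as `Row_S7d` (the second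
conjunct of the fact, verbatim under the fact's hypotheses) so that a tree proof of (d) alone closes
it by name: `row_S7d_excluded` in `ScenarioCensusPeriodicSlabLiouville.lean` (this seat). -/

/-- Census row S7 — (steady · NO symmetry · bounded smooth steady solutions on `ℝ³`, any `ν > 0`,
axially `L`-periodic): BY NAME the typed fact `BangGuiWangXie2025_periodicSlab_liouville`
(Bang–Gui–Wang–Xie, J. Fluid Mech. 1005 (2025) A6 = arXiv:2205.13259, Thm 1.4: (a)/(b)/(c) ⇒
`U ≡ c e₃`; (d) `sup ‖U‖ < 2πν/L` ⇒ `U` constant). Value of the composite fact: PRINT (cases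
(a)–(c) are not proved in the tree); the census cell S7 is case (d) = `Row_S7d`. -/
def Row_S7 : Prop :=
  FluidPDE.BangGuiWangXie2025_periodicSlab_liouville

/-- Census row S7d — case (d) of S7 alone (steady · NO symmetry · bounded smooth steady solution on
`ℝ³`, `ν > 0`, axially `L`-periodic, SMALL period–Reynolds number `sup ‖U‖ < 2πν/L`): `U` is a
constant vector. Literally the second conjunct of `Row_S7` under the fact's common hypotheses
(`row_S7d_of_row_S7`); PROVED in the tree (`row_S7d_excluded`,
`ScenarioCensusPeriodicSlabLiouville.lean`: Wirtinger in `x₃` + dyadic Saint-Venant + the tree's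
`2½`D Liouville theorem). -/
def Row_S7d : Prop :=
  ∀ ν : ℝ, 0 < ν → ∀ L : ℝ, 0 < L →
    ∀ (U : EuclideanSpace ℝ (Fin 3) → EuclideanSpace ℝ (Fin 3)) (P : EuclideanSpace ℝ (Fin 3) → ℝ),
      FluidPDE.IsLerayProfile ν 0 U P → ContDiff ℝ (⊤ : ℕ∞) U → ContDiff ℝ (⊤ : ℕ∞) P →
      (∃ M : ℝ, ∀ x, ‖U x‖ ≤ M) → FluidPDE.IsAxiallyPeriodic L U →
        (∃ M : ℝ, M < 2 * Real.pi * ν / L ∧ ∀ x, ‖U x‖ ≤ M) →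
          ∃ C : EuclideanSpace ℝ (Fin 3), U = fun _ => C

/-- S7 ⇒ S7d (the second conjunct of the printed theorem). -/
theorem row_S7d_of_row_S7 (h : Row_S7) : Row_S7d :=
  fun ν hν L hL U P hUP hU hP hbdd hper hsmall => (h ν hν L hL U P hUP hU hP hbdd hper).2 hsmall

end Summit.NavierStokesRegularity.NavierStokesRegularity.Theorems.ScenarioCensus

end
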